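import Literature.MathematicalPhysics.QuantumFieldTheory.ConformalBootstrap3D.PointKernelK34L515.Cert

/-!
# K34L515 instance, cell `l6c10` (parts file: groups 0:32)

Kernel-v3 cell of the point-functional exclusion instance for the lower box `Δσ ∈ [0.515, 0.520]`,
`Δε ∈ [0.6, 0.95)` (certificate `certL515`, module `PointKernelK34L515.Cert`): spin `ℓ = 6`,
`Δ ∈ [245/32, 249/32)` (centre `A`, half-width `2^-4`), Taylor degree `4`, `n_F = 50`, `1` s-piece(s)
covering `s = Δσ ∈ [103/200, 13/25]`.  Group theorems `l6c10_part<i>_<a>_<b> : gPart … = some <literal>` are checked by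
`decide +kernel` (the literals were produced by `#eval` of the same function); the cell numbers `l6c10_num<i> ≥ 0`
likewise; `l6c10_block` is `PKTM.blockPositive_of_cellPass` applied to them. This file holds only group theorems (the cell stated as a literal); the final file of the cell imports it.  Generated by
`gen/mk_v3cell.py` / `gen/drive_v3.py` (typer-g8).  [folklore]
-/

set_option Elab.async false

namespace Literature.MathematicalPhysics.QuantumFieldTheory.ConformalBootstrap3D

namespace PointKernelK34L515

open PointKernel PKTM
open Literature.Analysis.ValidatedNumerics.PolyMP
open Literature.Analysis.ValidatedNumerics.NumericsMP

/-- group model literal [folklore] -/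
def l6c10_g0_32_34 : G3 := ([⟨571094117469222700956314254017624535636, 571094118281830908741052764043116956902⟩, ⟨58164354458187399465798322867292370626, 58164355818820846644637615470384014849⟩, ⟨278690144531809027743686199433210484, 278691848369234195984306358042015435⟩, ⟨1317128398197542099582498024414206844, 1317130099875408837915490216336098415⟩, ⟨-686442915380353523669087445684092426, -686441471552296156265432529835902886⟩], [⟨-6882862649477253020284686274987152980, -6882862639754738845615775563498766221⟩, ⟨-697059703925726803249821969093509104, -697059687532693358006715061281415416⟩, ⟨-5563313836845993238586433091212949, -5563293306408006905839405848297220⟩, ⟨-15181494028758659091289417184601431, -15181473521562395698353640747381192⟩, ⟨8091593101535534678240919161315496, 8091610504037431890984180847835692⟩], [⟨41960225265236133719828293227817603, 41960225324390430696442049885149043⟩, ⟨4244968965671670340886931454110826, 4244969065632422878407884051331434⟩, ⟨39354243718765276262081632867760, 39354368924550010160149803361731⟩, ⟨91194957118978118973147345908631, 91195082204963442190772851070923⟩, ⟨-48939691688683255140199369522299, -48939585518267845119387713017961⟩])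

/-- group `[32, 34)` of piece 0 [folklore] -/
theorem l6c10_part0_32_34 : gPart certL515 (⟨6, ((247 : ℚ) / 32), 4, 4, 50, 6, 64, ⟨3, 0, 5, 110, 0, 0⟩⟩ : TMCell) (pc ps1 0) 32 34 = some l6c10_g0_32_34 := by decide +kernel

end PointKernelK34L515

end Literature.MathematicalPhysics.QuantumFieldTheory.ConformalBootstrap3D
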